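import Literature.AlgebraicGeometry.ModuliOfAbelianVarieties.SiegelFineModuliPoints          -- ★ FINE-MODULI POINTS `eq_of_isBaseChangeVia_id`
import Literature.AlgebraicGeometry.AbelianSchemes.PolarizedTupleIsoAlongBaseChange           -- ★ (O5′) TUPLE-ISO ALONG π `exists_isBaseChangeVia_id_baseChange_iff_of_isBaseChangeVia`
import Literature.AlgebraicGeometry.Motives.UniversallyInjectiveOfGeometricFibrePoints       -- ★ p847641 `algPoints_map_injective_of_injective_algPoints`
import Literature.AlgebraicGeometry.Motives.GaloisThickening                                 -- ★ `thickeningLift`, `map_thickeningπ_thickeningLift`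
import Literature.AlgebraicGeometry.Motives.VarietiesProperProofs                            -- ★ `IsProjectiveOver.isProper`
import Literature.AlgebraicGeometry.Motives.BaseChangeProofs                                 -- ★ `IsProjectiveOver.baseChange_obj`
import HarnessLib

/-!
# A SLICE INTO THE SIEGEL FINE MODULI SCHEME SEPARATES POINTS BY ITS PULLED-BACK TUPLE — on `Ω`-points, and on every sheet of the Galois thickening
# ([MumfordFogartyKirwan1994] Ch. 7 §2 Def. 7.2, §3 Thm. 7.9; [Deligne1971TravauxShimura] 4.16; [StacksProject] Tag 01S4)

Layer `Literature/AlgebraicGeometry/ModuliOfAbelianVarieties`, namespace `Literature.AlgebraicGeometry.ModuliOfAbelianVarieties.SiegelFineModuliScheme`.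
THEOREMS ONLY (no definition, no named fact, no instance, no notation, no `sorry`).  Cell `hodgecm-mathlib` (D-0151), P6 «MOD programme»
(crux hLiu418 = stmt-HodgeConjecture-24832, `--supports`, count-neutral); «L4» organ (S-E) «`ESepAt` OF ANY WITNESS BY VALUE» (LA4-p01 (g2) DEFAULT,
census 2026-09-02T04:52Z): the E-side point-separation conjunct `ESepAt S Kc w (Ef i)` of GEN՚s `RecordGENChoicesCofinal` (leaf `F0_P6a_PELSpread`
`stub_ELAWS` ⟶ `stub_GEN`), in LITERATURE VOCABULARY (a Theorems∕Literature file may not import a `Cruxes/…/Lines` leaf): the P-line letter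
`ESepAt S Kc w E := ∀ e′ y₁ y₂, tupleIsoAt (ℓ_{e′} y₁).left (ℓ_{e′} y₂).left E.P.A E.ρ E.P.D E.P.pol E.P.level → y₁ = y₂` follows from the E-line՚s
ED. 5 fields `E.𝓜 E.ε E.isBaseChange E.sep` by `eq_of_tupleRel_id_thickeningLift` below in three lines (drop the `𝒪`-action clause of `tupleIsoAt`).
HC_CM is proved only modulo the 2 remaining named inputs (hLiu418 24832, h413 24833) until rung 0 closes; nothing here is about HC.

THE MATHEMATICS.  Let `𝓜 = (M, univ, classify)` be a fine moduli scheme over `ℚ` of polarised abelian schemes with level-`N` structure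
([MumfordFogartyKirwan1994] Thm. 7.9: for `N ≥ 3` the functor of Def. 7.2 is represented), `Fᵢ ⊇ ℚ` a field, `X` an `Fᵢ`-scheme with an
`Fᵢ`-morphism `ε : X → M ⊗_ℚ Fᵢ` («the slice»), and `P` a triple over `X` which IS the pull-back of `univ` along `ε` followed by the projection
`M ⊗_ℚ Fᵢ → M` (the five-clause relation ★ `PolarizedAbelianSchemeWithLevel.IsBaseChangeVia`).  (§1) If `ε` is injective on `Ω`-valued points, then
two `Ω`-points `Q₁, Q₂` of `X` at which the triples `Q₁^*P`, `Q₂^*P` are ISOMORPHIC (Def. 7.2: related along `𝟙_{Spec Ω}`) are EQUAL: the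
isomorphism re-bases along the relation `P → univ` to one of `(Qᵢ ≫ ε ≫ pr₁)^* univ` (★ TUPLE-ISO ALONG π), so the two composites
`Spec Ω → M` coincide because `M` is FINE (★ FINE-MODULI POINTS, uniqueness in `classify`), hence `ε(Q₁) = ε(Q₂)` as `Fᵢ`-points of the fibre
product `M ⊗_ℚ Fᵢ` (same first projection, same structure map to `Spec Fᵢ`), and injectivity of `ε` concludes.  (§2) When `X = C ⊗_F Fᵢ` for a
PROJECTIVE `F`-scheme `C` and `ε` is injective on `Ω₀`-points along ONE embedding `τ : Fᵢ → Ω₀` into an algebraically closed field (the E-line՚s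
`sep`, on complex points), `ε` is injective on `Ω`-points along EVERY `e : Fᵢ → Ω` ([StacksProject] Tag 01S4, ★ p847641: `ε` is separated because
`X → Spec Fᵢ` is proper, `X` is locally of finite type), and the `Ω`-points of `C` read on the sheet `e` of the thickening
`R_{Fᵢ} C = (C ⊗_F Fᵢ)|_F` through the section `ℓ_e : C(Ω) → (R_{Fᵢ} C)(Ω)`, `y ↦ (y, Spec e)` (★ `thickeningLift`), are `Ω`-points of `X` along `e`;
`ℓ_e` is a section of the projection (★ `map_thickeningπ_thickeningLift`), so `y₁ = y₂`.

* §1 `eq_of_tupleRel_id_of_isBaseChangeVia_of_injective` — separation of `Ω`-points of `X` over `Fᵢ`.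
* §2 `IsProjectiveOver.algPoints_map_injective_baseChange_of_injective` (namespace `Literature.AlgebraicGeometry.Motives`; the `Ω`-injectivity of the
  slice along any `e`, from one algebraically closed `τ`),
  `eq_of_tupleRel_id_thickeningLift` — THE HEAD: separation of the `Ω`-points of `C` on every sheet `e`.

## References
* [MumfordFogartyKirwan1994] D. Mumford, J. Fogarty, F. Kirwan, *Geometric Invariant Theory*, 3rd ed. (1994), Ch. 7 §2 Definition 7.2 (p. 129),
  §3 Theorem 7.9 (p. 139).
* [Deligne1971TravauxShimura] P. Deligne, *Travaux de Shimura*, Sém. Bourbaki 389 (1971), 4.16 (p. 150); Prop. 1.15.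
* [StacksProject] The Stacks project, Tag 01S4 (universally injective ⇔ injective on field-valued points).
* [GortzWedhorn2020] U. Görtz, T. Wedhorn, *Algebraic Geometry I*, 2nd ed. (2020), §(4.8)–(4.9), Prop. 4.16 (p. 101).
-/

set_option autoImplicit false

noncomputable section

-- Mathlib's `Over`∕pull-back API is stated across semireducible wrappers (as in the ★ `AbelianSchemes/*` files).
set_option backward.isDefEq.respectTransparency false

open CategoryTheory CategoryTheory.Limits AlgebraicGeometry

namespace Literature.AlgebraicGeometry.ModuliOfAbelianVarieties

namespace SiegelFineModuliScheme

open Literature.AlgebraicGeometry.Motives (SchemeOver AlgPoints specOver baseChange thickening thickeningLift thickeningπ IsProjectiveOver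
  map_thickeningπ_thickeningLift thickeningLift_left_comp_snd algPoints_map_injective_of_injective_algPoints)
open Literature.AlgebraicGeometry.Motives.AbelianVariety (bcSpec)
open Literature.AlgebraicGeometry.AbelianSchemes (PolarizedAbelianSchemeWithLevel)

variable {g N : ℕ} {δ : Fin g → ℕ} (𝓜 : SiegelFineModuliScheme g N δ)

/-! ### §1 A slice injective on `Ω`-points separates `Ω`-points by its pulled-back tuple -/

section Slice

variable {Fi : Type} [Field Fi] [CharZero Fi] {X : SchemeOver Fi}
  (ε : X ⟶ (baseChange ℚ Fi).obj 𝓜.M) (P : PolarizedAbelianSchemeWithLevel g N δ X.left)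
  {G : P.A.X.left ⟶ 𝓜.univ.A.X.left} {Ĝ : P.D.hat.X.left ⟶ 𝓜.univ.D.hat.X.left}

/-- The structure square of an `Ω`-point of `X` pushed into `M`: `(Q ≫ ε ≫ pr₁) ≫ (M → Spec ℚ) = (Spec Ω → Spec Fᵢ) ≫ (Spec Fᵢ → Spec ℚ)`
(`pr₁ ≫ (M → Spec ℚ) = pr₂ ≫ (Spec Fᵢ → Spec ℚ)`, `ε` and `Q` are `Fᵢ`-morphisms). [cite: GortzWedhorn2020, Section (4.8)–(4.9)] -/
theorem algPoints_left_comp_slice_comp_fst_comp_hom {Ω : Type} [Field Ω] [Algebra Fi Ω] (Q : AlgPoints X Ω) :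
    (Q.left ≫ ε.left ≫ pullback.fst 𝓜.M.hom (bcSpec ℚ Fi)) ≫ 𝓜.M.hom =
      Spec.map (CommRingCat.ofHom (algebraMap Fi Ω)) ≫ bcSpec ℚ Fi := by
  have hQ : Q.left ≫ X.hom = Spec.map (CommRingCat.ofHom (algebraMap Fi Ω)) := Over.w Q
  have hε : ε.left ≫ pullback.snd 𝓜.M.hom (bcSpec ℚ Fi) = X.hom := Over.w ε
  simp only [Category.assoc]
  rw [pullback.condition, ← hQ, ← hε]
  simp only [Category.assoc]

/-- **§1 — A SLICE INJECTIVE ON `Ω`-POINTS SEPARATES `Ω`-POINTS BY ITS PULLED-BACK TRIPLE.**  `𝓜` a fine moduli scheme over `ℚ`, `ε : X → M ⊗_ℚ Fᵢ`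
an `Fᵢ`-morphism injective on `Ω`-valued points, `P` a triple over `X` which is the pull-back of `univ` along `ε ≫ pr₁` (five-clause relation via
`G`, `Ĝ`).  If the triples `Q₁^*P`, `Q₂^*P` at two `Ω`-points of `X` are ISOMORPHIC — the four conjuncts of ★ `PolarizedAbelianSchemeWithLevel.IsBaseChangeVia`
along `𝟙_{Spec Ω}`, UNPACKAGED over `P.A∕P.D∕P.level∕P.pol .baseChange Qᵢ.left` (the components of ★ `PolarizedAbelianSchemeWithLevel.baseChange` are
these by `rfl`; this is the P6a `tupleIsoAt Q₁.left Q₂.left P.A ρ P.D P.pol P.level` minus its `𝒪`-action clause) — then `Q₁ = Q₂`.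
[cite: MumfordFogartyKirwan1994, Ch. 7 §2 Definition 7.2 (p. 129) and §3 Theorem 7.9 (p. 139)] [cite: Deligne1971TravauxShimura, 4.16 p. 150] -/
theorem eq_of_tupleRel_id_of_isBaseChangeVia_of_injective
    (hP : P.IsBaseChangeVia 𝓜.univ (ε.left ≫ pullback.fst 𝓜.M.hom (bcSpec ℚ Fi)) G Ĝ)
    {Ω : Type} [Field Ω] [Algebra Fi Ω] (hinj : Function.Injective (AlgPoints.map (L := Ω) ε))
    (Q₁ Q₂ : AlgPoints X Ω)
    {H : (P.A.baseChange Q₁.left).X.left ⟶ (P.A.baseChange Q₂.left).X.left}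
    {Ĥ : (P.D.baseChange Q₁.left).hat.X.left ⟶ (P.D.baseChange Q₂.left).hat.X.left}
    (h : (P.level.baseChange Q₁.left).IsBaseChangeVia (P.level.baseChange Q₂.left) (𝟙 _) H ∧
      (P.D.baseChange Q₁.left).hat.IsBaseChangeVia (P.D.baseChange Q₂.left).hat (𝟙 _) Ĥ ∧
      (∃ (wH : (P.A.baseChange Q₁.left).X.hom ≫ 𝟙 _ = H ≫ (P.A.baseChange Q₂.left).X.hom)
          (wĤ : (P.D.baseChange Q₁.left).hat.X.hom ≫ 𝟙 _ = Ĥ ≫ (P.D.baseChange Q₂.left).hat.X.hom),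
        Nonempty ((Scheme.Modules.pullback
          (pullback.map (P.A.baseChange Q₁.left).X.hom (P.D.baseChange Q₁.left).hat.X.hom
            (P.A.baseChange Q₂.left).X.hom (P.D.baseChange Q₂.left).hat.X.hom H Ĥ (𝟙 _) wH wĤ)).obj
            (P.D.baseChange Q₂.left).P ≅ (P.D.baseChange Q₁.left).P)) ∧
      (P.pol.baseChange Q₁.left).lam.left ≫ Ĥ = H ≫ (P.pol.baseChange Q₂.left).lam.left) : Q₁ = Q₂ := by
  -- the isomorphism of triples `Q₁^*P ≅ Q₂^*P` (components of `P.baseChange` by `rfl`)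
  have hiso : (P.baseChange Q₁.left).IsBaseChangeVia (P.baseChange Q₂.left) (𝟙 _) H Ĥ := h
  -- re-base along the relation `P → univ` over `π := ε ≫ pr₁`
  obtain ⟨H', Ĥ', h'⟩ :=
    (PolarizedAbelianSchemeWithLevel.exists_isBaseChangeVia_id_baseChange_iff_of_isBaseChangeVia hP Q₁.left Q₂.left).mp ⟨H, Ĥ, hiso⟩
  -- `Spec Ω` as a `ℚ`-scheme through `Q₁`, and the two composites `Spec Ω → M` as `ℚ`-morphisms
  let T : SchemeOver ℚ := Over.mk ((Q₁.left ≫ ε.left ≫ pullback.fst 𝓜.M.hom (bcSpec ℚ Fi)) ≫ 𝓜.M.hom)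
  haveI : IsLocallyNoetherian T.left := by
    change IsLocallyNoetherian (Spec (.of Ω))
    infer_instance
  let x₁ : T ⟶ 𝓜.M := Over.homMk (Q₁.left ≫ ε.left ≫ pullback.fst 𝓜.M.hom (bcSpec ℚ Fi)) rfl
  let x₂ : T ⟶ 𝓜.M := Over.homMk (Q₂.left ≫ ε.left ≫ pullback.fst 𝓜.M.hom (bcSpec ℚ Fi)) (by
    change (Q₂.left ≫ ε.left ≫ pullback.fst 𝓜.M.hom (bcSpec ℚ Fi)) ≫ 𝓜.M.hom =
      (Q₁.left ≫ ε.left ≫ pullback.fst 𝓜.M.hom (bcSpec ℚ Fi)) ≫ 𝓜.M.hom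
    rw [𝓜.algPoints_left_comp_slice_comp_fst_comp_hom ε Q₂, 𝓜.algPoints_left_comp_slice_comp_fst_comp_hom ε Q₁])
  -- FINE: the two composites agree
  have hx : x₁ = x₂ := 𝓜.eq_of_isBaseChangeVia_id T x₁ x₂ (G := H') (Ĝ := Ĥ') h'
  have hfst : Q₁.left ≫ ε.left ≫ pullback.fst 𝓜.M.hom (bcSpec ℚ Fi) = Q₂.left ≫ ε.left ≫ pullback.fst 𝓜.M.hom (bcSpec ℚ Fi) :=
    congrArg CommaMorphism.left hx
  -- hence `ε(Q₁) = ε(Q₂)` as `Fᵢ`-points of `M ⊗_ℚ Fᵢ`, and `ε` is injective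
  refine hinj ?_
  apply Over.OverMorphism.ext
  rw [AlgPoints.map_apply, AlgPoints.map_apply, Over.comp_left, Over.comp_left]
  apply pullback.hom_ext
  · simpa only [Category.assoc] using hfst
  · have hε : ε.left ≫ pullback.snd 𝓜.M.hom (bcSpec ℚ Fi) = X.hom := Over.w ε
    have h₂ : Q₁.left ≫ ε.left ≫ pullback.snd 𝓜.M.hom (bcSpec ℚ Fi) = Q₂.left ≫ ε.left ≫ pullback.snd 𝓜.M.hom (bcSpec ℚ Fi) := by
      rw [hε, Over.w Q₁, Over.w Q₂]
    simpa only [Category.assoc] using h₂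

end Slice

/-! ### §2 The sheet form: `Ω`-points of a projective `F`-scheme `C` read on the sheet `e` of the thickening `C ⊗_F Fᵢ` -/

section Sheet

variable {F : Type} [Field F] {Fi : Type} [Field Fi] [CharZero Fi] [Algebra F Fi] {C : SchemeOver F}
  (ε : (baseChange F Fi).obj C ⟶ (baseChange ℚ Fi).obj 𝓜.M)
  (P : PolarizedAbelianSchemeWithLevel g N δ ((baseChange F Fi).obj C).left)
  {G : P.A.X.left ⟶ 𝓜.univ.A.X.left} {Ĝ : P.D.hat.X.left ⟶ 𝓜.univ.D.hat.X.left}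

omit [CharZero Fi] in
/-- **INJECTIVE ON `Ω₀`-POINTS ALONG ONE ALGEBRAICALLY CLOSED `τ` ⇒ INJECTIVE ON `Ω`-POINTS ALONG EVERY `e`**, for an `Fᵢ`-morphism out of the base change
`C ⊗_F Fᵢ` of a PROJECTIVE `F`-scheme (★ p847641 [StacksProject] Tag 01S4 (1)⇒(2); its hypotheses: `C ⊗_F Fᵢ` is locally of finite type and
`ε` is separated, because `C ⊗_F Fᵢ → Spec Fᵢ` is proper — ★ `IsProjectiveOver.baseChange_obj`, ★ `IsProjectiveOver.isProper`, Mathlib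
`IsSeparated.of_comp`).  The E-line՚s `sep` (complex points along `τE`) read at `Ω̄_w`-points along any sheet.
[cite: StacksProject, Tag 01S4] [cite: GortzWedhorn2020, Prop. 4.16 (p. 101)] -/
theorem _root_.Literature.AlgebraicGeometry.Motives.IsProjectiveOver.algPoints_map_injective_baseChange_of_injective
    (hC : IsProjectiveOver C) {Y : SchemeOver Fi} (f : (baseChange F Fi).obj C ⟶ Y)
    {Ω₀ : Type} [Field Ω₀] [IsAlgClosed Ω₀] (τ : Fi →+* Ω₀)
    (hsep : letI := τ.toAlgebra; Function.Injective (AlgPoints.map (L := Ω₀) f))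
    (Ω : Type) [Field Ω] [Algebra Fi Ω] : Function.Injective (AlgPoints.map (L := Ω) f) := by
  haveI : IsProper ((baseChange F Fi).obj C).hom := (hC.baseChange_obj Fi).isProper
  haveI : IsSeparated (f.left ≫ Y.hom) := by rw [Over.w f]; infer_instance
  haveI : IsSeparated f.left := IsSeparated.of_comp f.left Y.hom
  exact algPoints_map_injective_of_injective_algPoints τ f hsep Ω

/-- **§2 HEAD — THE PULLED-BACK UNIVERSAL TRIPLE SEPARATES THE `Ω`-POINTS OF `C` ON EVERY SHEET.**  `C` a projective `F`-scheme, `X = C ⊗_F Fᵢ`,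
`ε : X → M ⊗_ℚ Fᵢ` an `Fᵢ`-morphism into the Siegel fine moduli scheme injective on `Ω₀`-points along one algebraically closed `τ : Fᵢ → Ω₀` (the
E-line՚s `sep`), `P` the pull-back of `univ` along `ε ≫ pr₁` (the E-line՚s `isBaseChange`), `e : Fᵢ →ₐ[F] Ω` a sheet and `y₁ y₂ ∈ C(Ω)`.  If the
triples of `P` at the sheet points `ℓ_e y₁`, `ℓ_e y₂` (★ `thickeningLift`) are ISOMORPHIC (the four unpackaged conjuncts along `𝟙_{Spec Ω}` — the P6a
`tupleIsoAt (ℓ_e y₁).left (ℓ_e y₂).left P.A ρ P.D P.pol P.level` minus its `𝒪`-action clause), then `y₁ = y₂`.  This is the P-line letter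
`ESepAt S Kc w E` for EVERY ED.-5 witness `E` (take `𝓜 ε P := E.𝓜 E.ε E.P`, `hP := E.isBaseChange`, `hsep := E.sep`, `hC := S.projective Kc`).
[cite: MumfordFogartyKirwan1994, Ch. 7 §2 Definition 7.2 (p. 129) and §3 Theorem 7.9 (p. 139)] [cite: Deligne1971TravauxShimura, 4.16 p. 150]
[cite: StacksProject, Tag 01S4] -/
theorem eq_of_tupleRel_id_thickeningLift (hC : IsProjectiveOver C)
    (hP : P.IsBaseChangeVia 𝓜.univ (ε.left ≫ pullback.fst 𝓜.M.hom (bcSpec ℚ Fi)) G Ĝ)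
    {Ω₀ : Type} [Field Ω₀] [IsAlgClosed Ω₀] (τ : Fi →+* Ω₀)
    (hsep : letI := τ.toAlgebra; Function.Injective (AlgPoints.map (L := Ω₀) ε))
    {Ω : Type} [Field Ω] [Algebra F Ω] (e : Fi →ₐ[F] Ω) (y₁ y₂ : AlgPoints C Ω)
    {H : (P.A.baseChange (thickeningLift e C y₁).left).X.left ⟶ (P.A.baseChange (thickeningLift e C y₂).left).X.left}
    {Ĥ : (P.D.baseChange (thickeningLift e C y₁).left).hat.X.left ⟶ (P.D.baseChange (thickeningLift e C y₂).left).hat.X.left}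
    (h : (P.level.baseChange (thickeningLift e C y₁).left).IsBaseChangeVia (P.level.baseChange (thickeningLift e C y₂).left) (𝟙 _) H ∧
      (P.D.baseChange (thickeningLift e C y₁).left).hat.IsBaseChangeVia (P.D.baseChange (thickeningLift e C y₂).left).hat (𝟙 _) Ĥ ∧
      (∃ (wH : (P.A.baseChange (thickeningLift e C y₁).left).X.hom ≫ 𝟙 _ = H ≫ (P.A.baseChange (thickeningLift e C y₂).left).X.hom)
          (wĤ : (P.D.baseChange (thickeningLift e C y₁).left).hat.X.hom ≫ 𝟙 _ =
            Ĥ ≫ (P.D.baseChange (thickeningLift e C y₂).left).hat.X.hom),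
        Nonempty ((Scheme.Modules.pullback
          (pullback.map (P.A.baseChange (thickeningLift e C y₁).left).X.hom (P.D.baseChange (thickeningLift e C y₁).left).hat.X.hom
            (P.A.baseChange (thickeningLift e C y₂).left).X.hom (P.D.baseChange (thickeningLift e C y₂).left).hat.X.hom H Ĥ (𝟙 _) wH wĤ)).obj
            (P.D.baseChange (thickeningLift e C y₂).left).P ≅ (P.D.baseChange (thickeningLift e C y₁).left).P)) ∧
      (P.pol.baseChange (thickeningLift e C y₁).left).lam.left ≫ Ĥ = H ≫ (P.pol.baseChange (thickeningLift e C y₂).left).lam.left) :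
    y₁ = y₂ := by
  -- `Ω` as an `Fᵢ`-algebra along the sheet `e`; the slice is injective on `Ω`-points along `e`
  letI : Algebra Fi Ω := (e : Fi →+* Ω).toAlgebra
  have hinj := hC.algPoints_map_injective_baseChange_of_injective ε τ hsep Ω
  -- the sheet points `ℓ_e yᵢ` ARE `Ω`-points of `X = C ⊗_F Fᵢ` over `Fᵢ` (their second coordinate is `Spec e`)
  let Q : AlgPoints C Ω → AlgPoints ((baseChange F Fi).obj C) Ω := fun y =>
    Over.homMk (thickeningLift e C y).left (thickeningLift_left_comp_snd e C y)
  have hQ : Q y₁ = Q y₂ := 𝓜.eq_of_tupleRel_id_of_isBaseChangeVia_of_injective ε P hP hinj (Q y₁) (Q y₂) (H := H) (Ĥ := Ĥ) h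
  -- so `ℓ_e y₁ = ℓ_e y₂`, and `ℓ_e` is a section of `π_C` on `Ω`-points
  have hℓ : thickeningLift e C y₁ = thickeningLift e C y₂ :=
    Over.OverMorphism.ext (by simpa only [Q, Over.homMk_left] using congrArg CommaMorphism.left hQ)
  simpa only [map_thickeningπ_thickeningLift] using congrArg (AlgPoints.map (thickeningπ C)) hℓ

end Sheet

end SiegelFineModuliScheme

end Literature.AlgebraicGeometry.ModuliOfAbelianVarieties

end
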